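import Summits.QuantumAdvantage.AdviceFreeQNC0.BlockCombJoin37
import Summits.QuantumAdvantage.AdviceFreeQNC0.WalkCoreCharge
import HarnessLib

/-!
# Cell qa-qnc0, `p = 3` — (J3) on a SUFFIX FIBRE of the walk game, part 1: explicit E4 rows; letters and forms restrict
# (prover qn-prover-3 g28; groundwork for the frame/charge independence of `BlockFibre37.PerOutputFormsHardConst`, file `PerOutputFormsFrame39`)

Mechanism = E6 (`WalkCoreCharge.chargePropagation`) for the FORMS class of (J3) (`BlockCombJoin37`): fix the last three walk bits `b` of an
input `glue3 a w b` (`a : Fin 0 → Bool` empty, window `w : Fin n → Bool`).  The walk game restricted to this fibre is a mixed game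
(`ringWinU_glue3_eq_mixedWinU`): the window strategy at charge `c + |b|` assisted by the EVEN outside triple of the three outside outputs, and E4
writes an even triple onto rows `0, 1`.  This file supplies the two ingredients that are specific to dense `𝔽₃`-forms:

* `ringWinU_tripleRows` — E4 (`evenTriple_isWalkRow`, whose statement hides the rows behind `∃`) with the rows EXPLICIT and no degree
  hypothesis: `y₀ = P_{σ+2} ⊕ (P_σ ∧ w₀)`, `y₁ = P_σ`, `y_g = 0 (g ≥ 2)`, `σ = (3 − c' mod 3) mod 3`;
* `xOfU_glue3_lt` / `xOfU_glue3_eq` / `xOfU_glue3_gt` — on the fibre the window letters `j ≤ n − 1` of the big game are the window game's letters,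
  the last window letter `x_n` is `¬(b₀ ⊕ x'_n)`, and the letters after the window do not depend on `w`;
* ★ `gateSum_glue3_suffix` — hence every dense form of the big game is a dense form of the window game plus a constant:
  `∃ ℓ' κ, ∀ w, gateSum ℓ (glue3 a w b) = gateSum ℓ' w + κ` (the coefficient of `x'_n` is negated when `b₀ = 0`).

WHAT THIS IS NOT: no hardness statement; the class closure, the counting over fibres and (J3) ⟺ x-frame are in `PerOutputFormsFrame39`; crux
`stmt-QuantumAdvantage-22907` untouched; no ledger item (D-0168 shelf).
-/

noncomputable section

namespace Summit.QuantumAdvantage.AdviceFreeQNC0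

open Classical
open Finset
open Literature.Computability.MetaComplexity

namespace BlockFibre37

/-! ### §1 E4 with explicit rows -/

/-- The residue bookkeeping of E4 (finite check; as `WalkCoreEvenTriple`'s private `key`). -/
private theorem key39 : ∀ (cm t : Fin 3) (b p0 p1 p2 : Bool), xor p0 (xor p1 p2) = false →
    decide (((if (xor (sel3 p0 p1 p2 ((3 - cm.val) % 3 + 2)) (sel3 p0 p1 p2 ((3 - cm.val) % 3) && b)) = true
              ∧ (cm.val + t.val) % 3 ≠ 0 then 1 else 0) +
        (if sel3 p0 p1 p2 ((3 - cm.val) % 3) = true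
              ∧ (cm.val + 1 + t.val + (if b = true then 1 else 0)) % 3 ≠ 0 then 1 else 0)) % 2 = 1) =
      sel3 p0 p1 p2 t.val := by
  decide

/-- `W_0(w) = 0`. -/
private theorem wtPrefix_zero39 {ℓ : ℕ} (w : Fin ℓ → Bool) : wtPrefix w 0 = 0 := by
  unfold wtPrefix; simp

/-- `W_1(w) = [w₀]` (`ℓ ≥ 1`). -/
private theorem wtPrefix_one39 {ℓ : ℕ} (hℓ : 1 ≤ ℓ) (w : Fin ℓ → Bool) :
    wtPrefix w 1 = if w ⟨0, hℓ⟩ = true then 1 else 0 := by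
  unfold wtPrefix
  have e : (univ.filter fun i : Fin ℓ => i.val < 1 ∧ w i = true) =
      if w ⟨0, hℓ⟩ = true then {⟨0, hℓ⟩} else ∅ := by
    ext i
    simp only [Finset.mem_filter, Finset.mem_univ, true_and, Nat.lt_one_iff]
    constructor
    · rintro ⟨hi, hw⟩
      have : i = ⟨0, hℓ⟩ := Fin.ext hi
      subst this
      rw [if_pos hw]; exact Finset.mem_singleton_self _
    · intro h
      split_ifs at h with hw
      · rw [Finset.mem_singleton] at h; subst h; exact ⟨rfl, hw⟩
      · exact absurd h (Finset.notMem_empty _)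
  rw [e]; split_ifs <;> simp

/-- **E4 with explicit rows.**  For an EVEN triple `P` (`P₀ ⊕ P₁ ⊕ P₂ ≡ 0`; no degree hypothesis) on `ℓ ≥ 1` bits and any charge `c'`, with
`σ = (3 − c' mod 3) mod 3`, the two-row strategy `y₀ = P_{σ+2} ⊕ (P_σ ∧ w₀)`, `y₁ = P_σ`, `y_g = 0` (`g ≥ 2`) wins at `w` iff `P_{|w| mod 3}(w)`.
(The proof of `evenTriple_isWalkRow`, whose statement hides the rows behind `∃`.) -/
theorem ringWinU_tripleRows {ℓ : ℕ} (hℓ : 1 ≤ ℓ) (c' : ℕ) (P : ℕ → (Fin ℓ → Bool) → Bool)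
    (hPeven : ∀ w, xor (P 0 w) (xor (P 1 w) (P 2 w)) = false) (w : Fin ℓ → Bool) :
    ringWinU c' (fun g w => if g.val = 0 then
        xor (P (((3 - c' % 3) % 3 + 2) % 3) w) (P ((3 - c' % 3) % 3) w && w ⟨0, hℓ⟩)
      else if g.val = 1 then P ((3 - c' % 3) % 3) w else false) w = P (wt w % 3) w := by
  set i0 : Fin ℓ := ⟨0, hℓ⟩ with hi0
  set σ : ℕ := (3 - c' % 3) % 3 with hσ
  set y : Fin (ℓ + 1) → (Fin ℓ → Bool) → Bool := fun g w =>
    if g.val = 0 then xor (P ((σ + 2) % 3) w) (P σ w && w i0)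
    else if g.val = 1 then P σ w else false with hy
  show ringWinU c' y w = P (wt w % 3) w
  have hℓ1 : 1 < ℓ + 1 := by omega
  set g0 : Fin (ℓ + 1) := ⟨0, by omega⟩ with hg0
  set g1 : Fin (ℓ + 1) := ⟨1, hℓ1⟩ with hg1
  have hv0 : g0.val = 0 := rfl
  have hv1 : g1.val = 1 := rfl
  have hg01 : g0 ≠ g1 := fun h => by have := congrArg Fin.val h; rw [hv0, hv1] at this; exact zero_ne_one this
  unfold ringWinU
  -- only positions `0` and `1` can be selected
  have hfilter : (univ.filter fun g : Fin (ℓ + 1) =>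
      y g w = true ∧ (c' + g.val + walkExp w g.val) % 3 ≠ 0) =
      ({g0, g1} : Finset (Fin (ℓ + 1))).filter fun g =>
        y g w = true ∧ (c' + g.val + walkExp w g.val) % 3 ≠ 0 := by
    ext g
    simp only [Finset.mem_filter, Finset.mem_univ, true_and, Finset.mem_insert, Finset.mem_singleton]
    constructor
    · rintro ⟨hyg, hc⟩
      refine ⟨?_, hyg, hc⟩
      by_cases h0 : g.val = 0
      · exact Or.inl (Fin.ext h0)
      · by_cases h1 : g.val = 1
        · exact Or.inr (Fin.ext h1)
        · simp only [hy, h0, h1, if_false] at hyg; exact absurd hyg Bool.false_ne_true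
    · rintro ⟨-, hyg, hc⟩; exact ⟨hyg, hc⟩
  rw [hfilter]
  set Q : Fin (ℓ + 1) → Prop := fun g => y g w = true ∧ (c' + g.val + walkExp w g.val) % 3 ≠ 0 with hQ
  have hcard : (({g0, g1} : Finset (Fin (ℓ + 1))).filter Q).card =
      (if Q g0 then 1 else 0) + (if Q g1 then 1 else 0) := by
    rw [Finset.filter_insert, Finset.filter_singleton]
    by_cases hQ0 : Q g0 <;> by_cases hQ1 : Q g1 <;> simp [hQ0, hQ1, hg01]
  rw [hcard]
  have hy0 : y g0 w = xor (P ((σ + 2) % 3) w) (P σ w && w i0) := by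
    show (if g0.val = 0 then xor (P ((σ + 2) % 3) w) (P σ w && w i0)
      else if g0.val = 1 then P σ w else false) = _
    rw [if_pos hv0]
  have hy1 : y g1 w = P σ w := by
    show (if g1.val = 0 then xor (P ((σ + 2) % 3) w) (P σ w && w i0)
      else if g1.val = 1 then P σ w else false) = _
    rw [if_neg (by rw [hv1]; exact one_ne_zero), if_pos hv1]
  have hE0 : walkExp w g0.val = wt w := by rw [hv0]; unfold walkExp; rw [wtPrefix_zero39, add_zero]
  have hE1 : walkExp w g1.val = wt w + (if w i0 = true then 1 else 0) := by
    rw [hv1]; unfold walkExp; rw [wtPrefix_one39 hℓ]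
  have hQ0 : Q g0 ↔ ((xor (P ((σ + 2) % 3) w) (P σ w && w i0)) = true ∧ (c' % 3 + wt w % 3) % 3 ≠ 0) := by
    rw [hQ]; show (y g0 w = true ∧ _) ↔ _
    rw [hy0, hE0, hv0]
    constructor <;> rintro ⟨h1, h2⟩ <;> exact ⟨h1, by omega⟩
  have hQ1 : Q g1 ↔ (P σ w = true ∧ (c' % 3 + 1 + wt w % 3 + (if w i0 = true then 1 else 0)) % 3 ≠ 0) := by
    rw [hQ]; show (y g1 w = true ∧ _) ↔ _
    rw [hy1, hE1, hv1]
    constructor <;> rintro ⟨h1, h2⟩ <;> refine ⟨h1, ?_⟩ <;> revert h2 <;>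
      cases w i0 <;> simp <;> omega
  have hsum : ((if Q g0 then 1 else 0) + (if Q g1 then 1 else 0) : ℕ) =
      (if ((xor (P ((σ + 2) % 3) w) (P σ w && w i0)) = true ∧ (c' % 3 + wt w % 3) % 3 ≠ 0) then 1 else 0) +
      (if (P σ w = true ∧ (c' % 3 + 1 + wt w % 3 + (if w i0 = true then 1 else 0)) % 3 ≠ 0) then 1 else 0) := by
    rw [if_congr hQ0 rfl rfl, if_congr hQ1 rfl rfl]
  rw [hsum]
  have hsel : ∀ j, sel3 (P 0 w) (P 1 w) (P 2 w) j = P (j % 3) w := by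
    intro j
    unfold sel3
    have hj : j % 3 = 0 ∨ j % 3 = 1 ∨ j % 3 = 2 := by omega
    rcases hj with h | h | h <;> simp [h]
  have K := key39 ⟨c' % 3, Nat.mod_lt _ (by norm_num)⟩ ⟨wt w % 3, Nat.mod_lt _ (by norm_num)⟩ (w i0)
    (P 0 w) (P 1 w) (P 2 w) (hPeven w)
  simp only [hsel, Nat.mod_mod] at K
  rw [← hσ] at K
  exact K

/-! ### §2 Letters and forms on a suffix fibre (empty prefix, window of `n` bits, suffix of `3` bits) -/

variable {n : ℕ}

/-- the suffix block is read at positions `≥ 0 + n`. -/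
private theorem glue3_suffix (a : Fin 0 → Bool) (w : Fin n → Bool) (b : Fin 3 → Bool) (k : Fin (0 + n + 3))
    (hk : 0 + n ≤ k.val) : glue3 a w b k = b ⟨k.val - (0 + n), by omega⟩ := by
  have e : k = Fin.natAdd (0 + n) ⟨k.val - (0 + n), by omega⟩ := Fin.ext (by simp; omega)
  rw [congrArg (glue3 a w b) e]
  unfold glue3
  rw [Fin.append_right]

/-- the window block is read at positions `< 0 + n` (as `glue3_mid` of `WindowLocal`). -/
private theorem glue3_window (a : Fin 0 → Bool) (w : Fin n → Bool) (b : Fin 3 → Bool) (k : Fin (0 + n + 3))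
    (hk : k.val < n) : glue3 a w b k = w ⟨k.val, hk⟩ := by
  have e : k = Fin.castAdd 3 (Fin.natAdd 0 ⟨k.val, hk⟩) := Fin.ext (by simp)
  rw [congrArg (glue3 a w b) e]
  unfold glue3
  rw [Fin.append_left, Fin.append_right]

/-- Inside the window the glued input reads `w`. -/
theorem uExt_glue3_lt (a : Fin 0 → Bool) (w : Fin n → Bool) (b : Fin 3 → Bool) {m : ℕ} (hm : m < n) :
    uExt (glue3 a w b) m = uExt w m := by
  unfold uExt
  rw [dif_pos (show m < 0 + n + 3 by omega), dif_pos hm, glue3_window a w b ⟨m, by omega⟩ hm]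

/-- After the window the glued input does not read `w`. -/
theorem uExt_glue3_ge (a : Fin 0 → Bool) (w w₀ : Fin n → Bool) (b : Fin 3 → Bool) {m : ℕ} (hm : n ≤ m) :
    uExt (glue3 a w b) m = uExt (glue3 a w₀ b) m := by
  unfold uExt
  by_cases h : m < 0 + n + 3
  · rw [dif_pos h, dif_pos h, glue3_suffix a w b ⟨m, h⟩ (by show 0 + n ≤ m; omega),
      glue3_suffix a w₀ b ⟨m, h⟩ (by show 0 + n ≤ m; omega)]
  · rw [dif_neg h, dif_neg h]

/-- The first suffix bit sits at position `n`. -/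
theorem uExt_glue3_eq (a : Fin 0 → Bool) (w : Fin n → Bool) (b : Fin 3 → Bool) :
    uExt (glue3 a w b) n = b ⟨0, by omega⟩ := by
  unfold uExt
  rw [dif_pos (show n < 0 + n + 3 by omega), glue3_suffix a w b ⟨n, by omega⟩ (by show 0 + n ≤ n; omega)]
  congr 1; ext; simp

/-- The window game's own convention `u_n = 1`. -/
theorem uExt_self_eq (w : Fin n → Bool) : uExt w n = true := by
  unfold uExt; rw [dif_neg (lt_irrefl n)]

/-- **Window letters**: for `m + 1 ≤ n`, letter `m` of the big game on the fibre is letter `m` of the window game. -/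
theorem xOfU_glue3_lt (a : Fin 0 → Bool) (w : Fin n → Bool) (b : Fin 3 → Bool) {m : ℕ} (hm : m + 1 ≤ n)
    (h1 : m < 0 + n + 3 + 1) (h2 : m < n + 1) :
    xOfU (glue3 a w b) ⟨m, h1⟩ = xOfU w ⟨m, h2⟩ := by
  unfold xOfU
  rw [uExt_glue3_lt a w b (show m < n by omega)]
  by_cases h0 : m = 0
  · rw [if_pos h0, if_pos h0]
  · rw [if_neg h0, if_neg h0, uExt_glue3_lt a w b (show m - 1 < n by omega)]

/-- **The last window letter flips with `b₀`**: `x_n(glue3 a w b) = ¬(b₀ ⊕ x'_n(w))`. -/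
theorem xOfU_glue3_eq (a : Fin 0 → Bool) (w : Fin n → Bool) (b : Fin 3 → Bool) (hn : 1 ≤ n)
    (h1 : n < 0 + n + 3 + 1) :
    xOfU (glue3 a w b) ⟨n, h1⟩ = !(xor (b ⟨0, by omega⟩) (xOfU w ⟨n, lt_add_one n⟩)) := by
  unfold xOfU
  rw [if_neg (by omega : n ≠ 0), if_neg (by omega : n ≠ 0), uExt_glue3_eq, uExt_self_eq,
    uExt_glue3_lt a w b (show n - 1 < n by omega)]
  generalize b ⟨0, _⟩ = b0
  cases b0 <;> cases uExt w (n - 1) <;> rfl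

/-- **Outside letters**: after the window the letters do not depend on `w`. -/
theorem xOfU_glue3_gt (a : Fin 0 → Bool) (w w₀ : Fin n → Bool) (b : Fin 3 → Bool) (j : Fin (0 + n + 3 + 1))
    (hj : n < j.val) : xOfU (glue3 a w b) j = xOfU (glue3 a w₀ b) j := by
  unfold xOfU
  rw [uExt_glue3_ge a w w₀ b (show n ≤ j.val by omega)]
  by_cases h0 : j.val = 0
  · rw [if_pos h0, if_pos h0]
  · rw [if_neg h0, if_neg h0, uExt_glue3_ge a w w₀ b (show n ≤ j.val - 1 by omega)]

/-- **Forms restrict to forms**: on the suffix fibre every dense form of the big game is a dense form of the window game plus a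
constant (the last window letter's coefficient is negated when `b₀ = 0`). -/
theorem gateSum_glue3_suffix (hn : 1 ≤ n) (L : Fin (0 + n + 3 + 1) → ZMod 3) (a : Fin 0 → Bool) (b : Fin 3 → Bool) :
    ∃ (L' : Fin (n + 1) → ZMod 3) (κ : ZMod 3), ∀ w : Fin n → Bool, gateSum L (glue3 a w b) = gateSum L' w + κ := by
  set w₀ : Fin n → Bool := fun _ => false with hw₀
  set F₀ : ℕ → ZMod 3 := fun m =>
    if h : m < 0 + n + 3 + 1 then (if xOfU (glue3 a w₀ b) ⟨m, h⟩ = true then L ⟨m, h⟩ else 0) else 0 with hF₀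
  set L' : Fin (n + 1) → ZMod 3 := fun i =>
    if i.val < n then L ⟨i.val, by omega⟩
    else (if b ⟨0, by omega⟩ = true then L ⟨n, by omega⟩ else -L ⟨n, by omega⟩) with hL'
  refine ⟨L', (if b ⟨0, by omega⟩ = true then 0 else L ⟨n, by omega⟩) + ∑ m ∈ Finset.Ico (n + 1) (0 + n + 3 + 1), F₀ m,
    fun w => ?_⟩
  set F : ℕ → ZMod 3 := fun m =>
    if h : m < 0 + n + 3 + 1 then (if xOfU (glue3 a w b) ⟨m, h⟩ = true then L ⟨m, h⟩ else 0) else 0 with hF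
  set G : ℕ → ZMod 3 := fun m =>
    if h : m < n + 1 then (if xOfU w ⟨m, h⟩ = true then L' ⟨m, h⟩ else 0) else 0 with hG
  have hLsum : gateSum L (glue3 a w b) = ∑ m ∈ Finset.Ico 0 (0 + n + 3 + 1), F m := by
    unfold gateSum; rw [Finset.sum_fin_eq_sum_range, Finset.range_eq_Ico]
  have hRsum : gateSum L' w = ∑ m ∈ Finset.Ico 0 (n + 1), G m := by
    unfold gateSum; rw [Finset.sum_fin_eq_sum_range, Finset.range_eq_Ico]
  rw [hLsum, hRsum, ← Finset.sum_Ico_consecutive F (show 0 ≤ n by omega) (show n ≤ 0 + n + 3 + 1 by omega),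
    ← Finset.sum_Ico_consecutive F (show n ≤ n + 1 by omega) (show n + 1 ≤ 0 + n + 3 + 1 by omega),
    Nat.Ico_succ_singleton, Finset.sum_singleton, Finset.sum_Ico_succ_top (Nat.zero_le n)]
  -- the window part
  have h1 : ∑ m ∈ Finset.Ico 0 n, F m = ∑ m ∈ Finset.Ico 0 n, G m := by
    refine Finset.sum_congr rfl fun m hm => ?_
    have hmn : m < n := (Finset.mem_Ico.mp hm).2
    have e1 : F m = (if xOfU (glue3 a w b) ⟨m, by omega⟩ = true then L ⟨m, by omega⟩ else 0) := by
      rw [hF]; exact dif_pos (by omega)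
    have e2 : G m = (if xOfU w ⟨m, by omega⟩ = true then L' ⟨m, by omega⟩ else 0) := by
      rw [hG]; exact dif_pos (by omega)
    have e3 : L' ⟨m, by omega⟩ = L ⟨m, by omega⟩ := by rw [hL']; exact if_pos hmn
    rw [e1, e2, e3, xOfU_glue3_lt a w b (show m + 1 ≤ n by omega)]
  -- the outside part
  have h3 : ∑ m ∈ Finset.Ico (n + 1) (0 + n + 3 + 1), F m = ∑ m ∈ Finset.Ico (n + 1) (0 + n + 3 + 1), F₀ m := by
    refine Finset.sum_congr rfl fun m hm => ?_
    have hmn : n + 1 ≤ m ∧ m < 0 + n + 3 + 1 := Finset.mem_Ico.mp hm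
    have e1 : F m = (if xOfU (glue3 a w b) ⟨m, hmn.2⟩ = true then L ⟨m, hmn.2⟩ else 0) := by
      rw [hF]; exact dif_pos hmn.2
    have e2 : F₀ m = (if xOfU (glue3 a w₀ b) ⟨m, hmn.2⟩ = true then L ⟨m, hmn.2⟩ else 0) := by
      rw [hF₀]; exact dif_pos hmn.2
    rw [e1, e2, xOfU_glue3_gt a w w₀ b ⟨m, hmn.2⟩ (by show n < m; omega)]
  -- the boundary letter
  have h2 : F n = G n + (if b ⟨0, by omega⟩ = true then 0 else L ⟨n, by omega⟩) := by
    have e1 : F n = (if xOfU (glue3 a w b) ⟨n, by omega⟩ = true then L ⟨n, by omega⟩ else 0) := by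
      rw [hF]; exact dif_pos (by omega)
    have e2 : G n = (if xOfU w ⟨n, lt_add_one n⟩ = true then L' ⟨n, lt_add_one n⟩ else 0) := by
      rw [hG]; exact dif_pos (lt_add_one n)
    have e3 : L' ⟨n, lt_add_one n⟩ =
        (if b ⟨0, by omega⟩ = true then L ⟨n, by omega⟩ else -L ⟨n, by omega⟩) := by
      rw [hL']; exact if_neg (lt_irrefl n)
    rw [e1, e2, e3, xOfU_glue3_eq a w b hn]
    generalize b ⟨0, _⟩ = b0
    cases b0 <;> cases xOfU w ⟨n, lt_add_one n⟩ <;> simp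
  rw [h1, h2, h3]
  ring

end BlockFibre37

end Summit.QuantumAdvantage.AdviceFreeQNC0

end
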